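import Mathlib

/-!
# The filtration of the unit group of a discrete valuation ring by principal units
(kernel witness for the local half of the standard fact (A10) of the Tier-5 [A]-ledger)

The [A]-ledger of the toric-period section records, for the existence of conjugate-orthogonal
characters of every exact conductor at an inert place, the standard facts
«`U_E^{a−1}/U_E^a ≅ k_E` for `a ≥ 2`, `k_E^×` for `a = 1`» (the «local half» of (A10); the
group-theoretic half is the kernel file `T5FiniteIndexSeparation`).  This file proves the two
isomorphisms for an arbitrary discrete valuation ring `R` with uniformiser `ϖ` and residue field
`k = R/(ϖ)`, with `U_n := {u ∈ Rˣ | ϖ^n ∣ u − 1}` (so `U_0 = Rˣ`, `U_1` = the principal units):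

* `higherUnits ϖ n` — the subgroup `U_n ≤ Rˣ` (defined over any commutative ring);
* `toResidue` — for `n ≥ 1` the homomorphism `U_n → (R/(ϖ), +)`, `u ↦ (u − 1)/ϖ^n mod ϖ`,
  with kernel `U_{n+1}` (`ker_toResidue`) and, over a local ring with `ϖ` in the maximal ideal,
  surjective (`toResidue_surjective`: `1 + ϖ^n x` is a unit);
* `higherUnitsQuotEquiv` — `U_n / U_{n+1} ≃ (R/(ϖ), +)` for `n ≥ 1`, over a local domain with
  `ϖ ≠ 0` in the maximal ideal; `higherUnitsQuotEquivResidueField` — the same with the residue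
  field `k` of a discrete valuation ring (`ϖ` irreducible);
* `unitsQuotEquivResidueFieldUnits` — `Rˣ / U_1 ≃ k^×` for a discrete valuation ring;
* `card_higherUnits_quot` — `|U_n / U_{n+1}| = |k|` (`n ≥ 1`), `card_units_quot` — `|Rˣ/U_1| = |k^×|`.

Not modelled: the local field `E_v` itself (the unit group of its ring of integers is the `Rˣ`
here), the comparison with the subfield `F_v` (residue degree 2 at an inert place, which is what
makes `k_E` strictly larger than the image of `k_F`) — that comparison stays prose.
Mathlib-only; axioms standard.  Uses an L-value-free non-vanishing device: NO (README §8(d)).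
-/

namespace Summit.Ventures.HodgeRepro2.T5PrincipalUnitFiltration

section Subgroup

variable {R : Type*} [CommRing R]

/-- The `n`-th higher unit group `U_n = {u ∈ Rˣ | ϖ^n ∣ u − 1}` attached to an element `ϖ`. -/
def higherUnits (ϖ : R) (n : ℕ) : Subgroup Rˣ where
  carrier := {u | ϖ ^ n ∣ (u : R) - 1}
  one_mem' := by simp
  mul_mem' := by
    intro a b ha hb
    simp only [Set.mem_setOf_eq, Units.val_mul] at ha hb ⊢
    have h : (a : R) * b - 1 = ((a : R) - 1) * ((b : R) - 1) + ((a : R) - 1) + ((b : R) - 1) := by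
      ring
    rw [h]
    exact dvd_add (dvd_add (dvd_mul_of_dvd_left ha _) ha) hb
  inv_mem' := by
    intro a ha
    simp only [Set.mem_setOf_eq] at ha ⊢
    have h : ((a⁻¹ : Rˣ) : R) - 1 = -((a⁻¹ : Rˣ) : R) * ((a : R) - 1) := by
      rw [neg_mul, mul_sub, Units.inv_mul, mul_one, neg_sub]
    rw [h]
    exact dvd_mul_of_dvd_right ha _

variable (ϖ : R) (n : ℕ)

/-- Membership in `U_n`. -/
theorem mem_higherUnits {u : Rˣ} : u ∈ higherUnits ϖ n ↔ ϖ ^ n ∣ (u : R) - 1 :=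
  Iff.rfl

/-- `U_0 = Rˣ`. -/
theorem higherUnits_zero : higherUnits ϖ 0 = ⊤ := by
  ext u
  simp [mem_higherUnits]

/-- The filtration is decreasing: `U_{n+1} ≤ U_n`. -/
theorem higherUnits_succ_le : higherUnits ϖ (n + 1) ≤ higherUnits ϖ n := by
  intro u hu
  exact dvd_trans (pow_dvd_pow ϖ (Nat.le_succ n)) hu

/-- The filtration is antitone. -/
theorem higherUnits_antitone : Antitone (higherUnits ϖ) := by
  intro m n hmn u hu
  exact dvd_trans (pow_dvd_pow ϖ hmn) hu

/-- For a discrete valuation ring with uniformiser `ϖ`: `U_n = {u | u − 1 ∈ 𝔪^n}`. -/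
theorem mem_higherUnits_iff_mem_pow_maximalIdeal [IsDomain R] [IsDiscreteValuationRing R]
    (hϖ : Irreducible ϖ) {u : Rˣ} :
    u ∈ higherUnits ϖ n ↔ (u : R) - 1 ∈ IsLocalRing.maximalIdeal R ^ n := by
  rw [mem_higherUnits, hϖ.maximalIdeal_eq, Ideal.span_singleton_pow, Ideal.mem_span_singleton]

end Subgroup

section Cofactor

variable {R : Type*} [CommRing R] (ϖ : R) (n : ℕ)

/-- The cofactor `x` with `u − 1 = ϖ^n · x` (chosen; unique when `ϖ ≠ 0` in a domain). -/
noncomputable def cofactor (u : higherUnits ϖ n) : R :=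
  Classical.choose (u.2 : ∃ c, ((u : Rˣ) : R) - 1 = ϖ ^ n * c)

/-- `u − 1 = ϖ^n · cofactor u`. -/
theorem cofactor_spec (u : higherUnits ϖ n) : ((u : Rˣ) : R) - 1 = ϖ ^ n * cofactor ϖ n u :=
  Classical.choose_spec (u.2 : ∃ c, ((u : Rˣ) : R) - 1 = ϖ ^ n * c)

variable [IsDomain R]

/-- Uniqueness of the cofactor. -/
theorem eq_cofactor (hϖ0 : ϖ ≠ 0) (u : higherUnits ϖ n) {x : R}
    (hx : ((u : Rˣ) : R) - 1 = ϖ ^ n * x) : x = cofactor ϖ n u :=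
  mul_left_cancel₀ (pow_ne_zero n hϖ0) (hx.symm.trans (cofactor_spec ϖ n u))

/-- The cofactor of `1` is `0`. -/
theorem cofactor_one (hϖ0 : ϖ ≠ 0) : cofactor ϖ n 1 = 0 :=
  (eq_cofactor ϖ n hϖ0 1 (by simp)).symm

/-- The cofactor of a product: `c(uv) = ϖ^n c(u) c(v) + c(u) + c(v)`. -/
theorem cofactor_mul (hϖ0 : ϖ ≠ 0) (u v : higherUnits ϖ n) :
    cofactor ϖ n (u * v) = ϖ ^ n * cofactor ϖ n u * cofactor ϖ n v + cofactor ϖ n u +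
      cofactor ϖ n v := by
  refine (eq_cofactor ϖ n hϖ0 (u * v) ?_).symm
  have hu := cofactor_spec ϖ n u
  have hv := cofactor_spec ϖ n v
  have h : (((u * v : higherUnits ϖ n) : Rˣ) : R) - 1 =
      (((u : Rˣ) : R) - 1) * (((v : Rˣ) : R) - 1) + (((u : Rˣ) : R) - 1) +
        (((v : Rˣ) : R) - 1) := by
    simp only [Subgroup.coe_mul, Units.val_mul]
    ring
  rw [h, hu, hv]
  ring

/-- The cofactor of `1 + ϖ^n x` (as a unit) is `x`. -/
theorem cofactor_eq_of_eq (hϖ0 : ϖ ≠ 0) (u : higherUnits ϖ n) (x : R)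
    (hx : ((u : Rˣ) : R) = 1 + ϖ ^ n * x) : cofactor ϖ n u = x :=
  (eq_cofactor ϖ n hϖ0 u (by rw [hx]; ring)).symm

end Cofactor

section Residue

variable {R : Type*} [CommRing R] [IsDomain R] (ϖ : R) (n : ℕ)

/-- For `n ≥ 1`, the homomorphism `U_n → (R/(ϖ), +)`, `u ↦ (u − 1)/ϖ^n mod ϖ`
(written multiplicatively into `Multiplicative (R ⧸ (ϖ))`). -/
noncomputable def toResidue (hϖ0 : ϖ ≠ 0) (hn : 1 ≤ n) :
    higherUnits ϖ n →* Multiplicative (R ⧸ Ideal.span {ϖ}) where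
  toFun u := Multiplicative.ofAdd (Ideal.Quotient.mk (Ideal.span {ϖ}) (cofactor ϖ n u))
  map_one' := by
    simp [cofactor_one ϖ n hϖ0]
  map_mul' u v := by
    have h0 : Ideal.Quotient.mk (Ideal.span {ϖ}) (ϖ ^ n * cofactor ϖ n u * cofactor ϖ n v) = 0 := by
      rw [Ideal.Quotient.eq_zero_iff_mem, Ideal.mem_span_singleton]
      exact dvd_mul_of_dvd_left (dvd_mul_of_dvd_left (dvd_pow_self ϖ (by omega)) _) _
    show Multiplicative.ofAdd (Ideal.Quotient.mk (Ideal.span {ϖ}) (cofactor ϖ n (u * v))) = _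
    rw [cofactor_mul ϖ n hϖ0, (Ideal.Quotient.mk (Ideal.span {ϖ})).map_add,
      (Ideal.Quotient.mk (Ideal.span {ϖ})).map_add, h0, zero_add, ofAdd_add]

/-- The value of `toResidue`. -/
theorem toResidue_apply (hϖ0 : ϖ ≠ 0) (hn : 1 ≤ n) (u : higherUnits ϖ n) :
    toResidue ϖ n hϖ0 hn u =
      Multiplicative.ofAdd (Ideal.Quotient.mk (Ideal.span {ϖ}) (cofactor ϖ n u)) :=
  rfl

/-- The kernel of `toResidue` is `U_{n+1}`. -/
theorem toResidue_eq_one_iff (hϖ0 : ϖ ≠ 0) (hn : 1 ≤ n) (u : higherUnits ϖ n) :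
    toResidue ϖ n hϖ0 hn u = 1 ↔ (u : Rˣ) ∈ higherUnits ϖ (n + 1) := by
  rw [toResidue_apply, mem_higherUnits, ← ofAdd_zero, Multiplicative.ofAdd.apply_eq_iff_eq,
    Ideal.Quotient.eq_zero_iff_mem, Ideal.mem_span_singleton]
  constructor
  · rintro ⟨d, hd⟩
    refine ⟨d, ?_⟩
    rw [cofactor_spec ϖ n u, hd]
    ring
  · rintro ⟨d, hd⟩
    refine ⟨d, (eq_cofactor ϖ n hϖ0 u ?_).symm⟩
    rw [hd]
    ring

/-- The kernel of `toResidue` is `U_{n+1}` (as a subgroup of `U_n`). -/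
theorem ker_toResidue (hϖ0 : ϖ ≠ 0) (hn : 1 ≤ n) :
    (toResidue ϖ n hϖ0 hn).ker = (higherUnits ϖ (n + 1)).subgroupOf (higherUnits ϖ n) := by
  ext u
  rw [MonoidHom.mem_ker, Subgroup.mem_subgroupOf, toResidue_eq_one_iff]

/-- Over a local ring with `ϖ` in the maximal ideal, `toResidue` is surjective:
`1 + ϖ^n x` is a unit with cofactor `x`. -/
theorem toResidue_surjective [IsLocalRing R] (hϖ0 : ϖ ≠ 0)
    (hϖ : ϖ ∈ IsLocalRing.maximalIdeal R) (hn : 1 ≤ n) :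
    Function.Surjective (toResidue ϖ n hϖ0 hn) := by
  intro y
  obtain ⟨x, rfl⟩ := Ideal.Quotient.mk_surjective (Multiplicative.toAdd y)
  have hmem : -(ϖ ^ n * x) ∈ IsLocalRing.maximalIdeal R := by
    refine (IsLocalRing.maximalIdeal R).neg_mem ?_
    exact Ideal.mul_mem_right _ _ (Ideal.pow_mem_of_mem _ hϖ n (by omega))
  have hunit : IsUnit (1 + ϖ ^ n * x) := by
    have := IsLocalRing.isUnit_one_sub_self_of_mem_nonunits _
      ((IsLocalRing.mem_maximalIdeal _).mp hmem)
    simpa [sub_neg_eq_add] using this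
  let u : Rˣ := hunit.unit
  have hu : (u : R) = 1 + ϖ ^ n * x := hunit.unit_spec
  have humem : u ∈ higherUnits ϖ n := by
    rw [mem_higherUnits, hu]
    exact ⟨x, by ring⟩
  refine ⟨⟨u, humem⟩, ?_⟩
  rw [toResidue_apply, cofactor_eq_of_eq ϖ n hϖ0 ⟨u, humem⟩ x hu]
  rfl

/-- **`U_n / U_{n+1} ≃ (R/(ϖ), +)`** for `n ≥ 1`, over a local domain with `0 ≠ ϖ ∈ 𝔪`. -/
noncomputable def higherUnitsQuotEquiv [IsLocalRing R] (hϖ0 : ϖ ≠ 0)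
    (hϖ : ϖ ∈ IsLocalRing.maximalIdeal R) (hn : 1 ≤ n) :
    higherUnits ϖ n ⧸ (higherUnits ϖ (n + 1)).subgroupOf (higherUnits ϖ n) ≃*
      Multiplicative (R ⧸ Ideal.span {ϖ}) :=
  (QuotientGroup.quotientMulEquivOfEq (ker_toResidue ϖ n hϖ0 hn).symm).trans
    (QuotientGroup.quotientKerEquivOfSurjective _ (toResidue_surjective ϖ n hϖ0 hϖ hn))

/-- The cardinality statement: `|U_n / U_{n+1}| = |R/(ϖ)|` for `n ≥ 1`. -/
theorem card_higherUnits_quot [IsLocalRing R] (hϖ0 : ϖ ≠ 0)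
    (hϖ : ϖ ∈ IsLocalRing.maximalIdeal R) (hn : 1 ≤ n) :
    Nat.card (higherUnits ϖ n ⧸ (higherUnits ϖ (n + 1)).subgroupOf (higherUnits ϖ n)) =
      Nat.card (R ⧸ Ideal.span {ϖ}) :=
  Nat.card_congr (higherUnitsQuotEquiv ϖ n hϖ0 hϖ hn).toEquiv

end Residue

section DVR

variable {R : Type*} [CommRing R] [IsDomain R] [IsDiscreteValuationRing R] (ϖ : R) (n : ℕ)

/-- `R/(ϖ)` is the residue field when `ϖ` is a uniformiser. -/
noncomputable def quotSpanEquivResidueField (hϖ : Irreducible ϖ) :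
    R ⧸ Ideal.span {ϖ} ≃+* IsLocalRing.ResidueField R :=
  Ideal.quotEquivOfEq hϖ.maximalIdeal_eq.symm

/-- **`U_n / U_{n+1} ≃ (k, +)`** for `n ≥ 1`, `R` a discrete valuation ring with uniformiser `ϖ`
and residue field `k`. -/
noncomputable def higherUnitsQuotEquivResidueField (hϖ : Irreducible ϖ) (hn : 1 ≤ n) :
    higherUnits ϖ n ⧸ (higherUnits ϖ (n + 1)).subgroupOf (higherUnits ϖ n) ≃*
      Multiplicative (IsLocalRing.ResidueField R) :=
  (higherUnitsQuotEquiv ϖ n hϖ.ne_zero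
    (hϖ.maximalIdeal_eq ▸ Ideal.mem_span_singleton_self ϖ) hn).trans
    (AddEquiv.toMultiplicative (quotSpanEquivResidueField ϖ hϖ).toAddEquiv)

/-- `|U_n / U_{n+1}| = |k|` for `n ≥ 1`. -/
theorem card_higherUnits_quot_eq_card_residueField (hϖ : Irreducible ϖ) (hn : 1 ≤ n) :
    Nat.card (higherUnits ϖ n ⧸ (higherUnits ϖ (n + 1)).subgroupOf (higherUnits ϖ n)) =
      Nat.card (IsLocalRing.ResidueField R) :=
  Nat.card_congr (higherUnitsQuotEquivResidueField ϖ n hϖ hn).toEquiv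

/-- `U_1` is the kernel of the reduction map `Rˣ → k^×`. -/
theorem higherUnits_one_eq_ker (hϖ : Irreducible ϖ) :
    higherUnits ϖ 1 = (Units.map (IsLocalRing.residue R).toMonoidHom).ker := by
  ext u
  rw [MonoidHom.mem_ker, Units.ext_iff, Units.coe_map, Units.val_one]
  change u ∈ higherUnits ϖ 1 ↔ IsLocalRing.residue R (u : R) = 1
  rw [mem_higherUnits, pow_one, ← Ideal.mem_span_singleton, ← hϖ.maximalIdeal_eq,
    ← Ideal.Quotient.eq_zero_iff_mem, map_sub, map_one, sub_eq_zero]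
  rfl

/-- **`Rˣ / U_1 ≃ k^×`** for a discrete valuation ring with uniformiser `ϖ`. -/
noncomputable def unitsQuotEquivResidueFieldUnits (hϖ : Irreducible ϖ) :
    Rˣ ⧸ higherUnits ϖ 1 ≃* (IsLocalRing.ResidueField R)ˣ :=
  (QuotientGroup.quotientMulEquivOfEq (higherUnits_one_eq_ker ϖ hϖ)).trans
    (QuotientGroup.quotientKerEquivOfSurjective _
      (IsLocalRing.surjective_units_map_of_local_ringHom _ Ideal.Quotient.mk_surjective
        (inferInstanceAs (IsLocalHom (IsLocalRing.residue R)))))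

/-- `|Rˣ / U_1| = |k^×|`. -/
theorem card_units_quot (hϖ : Irreducible ϖ) :
    Nat.card (Rˣ ⧸ higherUnits ϖ 1) = Nat.card (IsLocalRing.ResidueField R)ˣ :=
  Nat.card_congr (unitsQuotEquivResidueFieldUnits ϖ hϖ).toEquiv

end DVR

end Summit.Ventures.HodgeRepro2.T5PrincipalUnitFiltration
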